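import Mathlib

/-!
# Counting characters trivial on a finite-index subgroup: `#{χ : G →* ℂˣ ∣ χ|_N = 1} = [G : N]`

Lemma N5.L4(iii) counts the conjugate-orthogonal characters of `E_v^×` of conductor `≤ n` as
«the characters of `E_v^×/F_v^×U_E^n`, a group of order `(q+1)q^{n-1}`», and then «exactly `q`
of conductor `1` and `(q+1)(q-1)` of conductor `2`» by subtraction. The two steps are pure finite
abelian duality:

* `card_ker_restrictHom` / `ncard_setOf_eq_one_on`: for a commutative group `G` and a subgroup `N`
  of finite index, the characters `G →* ℂˣ` trivial on `N` are exactly `[G : N]` in number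
  (`MonoidHom.restrictHomKerEquiv` + Mathlib's duality for the finite group `G ⧸ N`, `ℂ` having
  enough roots of unity);
* `ncard_setOf_eq_one_on_and_not`: for `N ≤ N'` the characters trivial on `N` but NOT on `N'`
  («exact level») are `[G : N] − [G : N']` in number.

Declaration per README §8(d): «uses an L-value-free non-vanishing device: NO».
-/

namespace Summit.Ventures.HodgeRepro2.T5CharacterCount

variable {G : Type*} [CommGroup G]

/-- The characters trivial on `N` are the kernel of the restriction map to `N`. -/
theorem mem_ker_restrictHom_iff (N : Subgroup G) (χ : G →* ℂˣ) :
    χ ∈ (MonoidHom.restrictHom N ℂˣ).ker ↔ ∀ y ∈ N, χ y = 1 := by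
  rw [MonoidHom.mem_ker, MonoidHom.restrictHom_apply, MonoidHom.restrict_eq_one_iff]

/-- THE COUNT: a subgroup `N` of finite index has exactly `[G : N]` characters `G →* ℂˣ` trivial
on it. -/
theorem card_ker_restrictHom (N : Subgroup G) (hN : N.index ≠ 0) :
    Nat.card (MonoidHom.restrictHom N ℂˣ).ker = N.index := by
  haveI : Finite (G ⧸ N) := Subgroup.index_ne_zero_iff_finite.mp hN
  rw [Nat.card_congr (MonoidHom.restrictHomKerEquiv ℂˣ N).toEquiv,
    CommGroup.card_monoidHom_of_hasEnoughRootsOfUnity (G ⧸ N) ℂ, Subgroup.index_eq_card]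

/-- The set of characters trivial on `N`, as a set. -/
theorem setOf_eq_one_on_eq (N : Subgroup G) :
    {χ : G →* ℂˣ | ∀ y ∈ N, χ y = 1} = ((MonoidHom.restrictHom N ℂˣ).ker : Set (G →* ℂˣ)) := by
  ext χ
  exact (mem_ker_restrictHom_iff N χ).symm

/-- `ncard` form of the count. -/
theorem ncard_setOf_eq_one_on (N : Subgroup G) (hN : N.index ≠ 0) :
    {χ : G →* ℂˣ | ∀ y ∈ N, χ y = 1}.ncard = N.index := by
  rw [setOf_eq_one_on_eq, ← Nat.card_coe_set_eq]
  exact card_ker_restrictHom N hN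

/-- The set of characters trivial on a finite-index subgroup is finite. -/
theorem finite_setOf_eq_one_on (N : Subgroup G) (hN : N.index ≠ 0) :
    {χ : G →* ℂˣ | ∀ y ∈ N, χ y = 1}.Finite := by
  rw [← Set.finite_coe_iff]
  apply Nat.finite_of_card_ne_zero
  rw [Nat.card_coe_set_eq, ncard_setOf_eq_one_on N hN]
  exact hN

/-- If `N ≤ N'` and `N` has finite index, so has `N'`. -/
theorem index_ne_zero_of_le {N N' : Subgroup G} (h : N ≤ N') (hN : N.index ≠ 0) :
    N'.index ≠ 0 := by
  intro h0
  exact hN (zero_dvd_iff.mp (h0 ▸ Subgroup.index_dvd_of_le h))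

/-- EXACT LEVEL: for `N ≤ N'` of finite index, the characters trivial on `N` but not on `N'` are
`[G : N] − [G : N']` in number (Lemma N5.L4(iii): «exactly `q` of conductor `1`, `(q+1)(q−1)` of
conductor `2`»). -/
theorem ncard_setOf_eq_one_on_and_not {N N' : Subgroup G} (h : N ≤ N') (hN : N.index ≠ 0) :
    {χ : G →* ℂˣ | (∀ y ∈ N, χ y = 1) ∧ ¬ ∀ y ∈ N', χ y = 1}.ncard = N.index - N'.index := by
  have hsub : {χ : G →* ℂˣ | ∀ y ∈ N', χ y = 1} ⊆ {χ : G →* ℂˣ | ∀ y ∈ N, χ y = 1} :=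
    fun χ hχ y hy => hχ y (h hy)
  have heq : {χ : G →* ℂˣ | (∀ y ∈ N, χ y = 1) ∧ ¬ ∀ y ∈ N', χ y = 1} =
      {χ : G →* ℂˣ | ∀ y ∈ N, χ y = 1} \ {χ : G →* ℂˣ | ∀ y ∈ N', χ y = 1} := by
    ext χ
    simp only [Set.mem_setOf_eq, Set.mem_sdiff]
  have hN' : N'.index ≠ 0 := index_ne_zero_of_le h hN
  rw [heq, Set.ncard_sdiff hsub (finite_setOf_eq_one_on N' hN'), ncard_setOf_eq_one_on N hN,
    ncard_setOf_eq_one_on N' hN']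

/-- The same count for characters with values in the unit circle would follow from the
`ℂˣ ↔ Circle` bridge; here we record the `ℂˣ`-valued statement with `Nat.card` on the subtype. -/
theorem card_subtype_eq_one_on (N : Subgroup G) (hN : N.index ≠ 0) :
    Nat.card {χ : G →* ℂˣ // ∀ y ∈ N, χ y = 1} = N.index := by
  rw [← card_ker_restrictHom N hN]
  exact Nat.card_congr (Equiv.subtypeEquivRight fun χ => (mem_ker_restrictHom_iff N χ).symm)

end Summit.Ventures.HodgeRepro2.T5CharacterCount
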